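import Literature.Geometry.Lorentzian.CoordHamiltonGradientFunction
import Literature.Geometry.Riemannian.RicciFlowScalarCurvatureEvolution
import Literature.Geometry.Riemannian.CurvatureNormSq
import Literature.Geometry.Riemannian.PerelmanEntropyFormulaManifold
import HarnessLib

/-!
# Hamilton's evolution inequality for `u = |∇R|²/R + N|E|² − ηR²` on the manifold
(stub `stub_gradientEstimates`, piece H0 `helper_hamiltonEvolution`, of line `margerin-cone-hamilton-rails`,
crux `EntropyRung.ChangGurskyYang`, item stmt-SmoothPoincare4-10834)

The PDE heart of Hamilton's gradient estimate for the scalar curvature (Hamilton 1982, §11,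
Lemmas 11.5–11.9 and Thm. 11.1; §17, Lemma 17.4; Huisken 1985, §4, Thm. 4.1 in dimension 4) is
the landed coordinate inequality `MetricCoord.IsMetricFamilyOn.derivWithin_hamiltonF_le`
(`Literature/Geometry/Lorentzian/CoordHamiltonGradientFunction.lean`): along `∂G/∂t = −2 Ric(G)`,
`F = |∇S|²/S + N(|Ric|² − S²/4)`, `N = 180(1 + Λ)`, satisfies
`∂ₜF ≤ ΔF − |∇S|² + N(64√|Rm|² + S)|E|²` at a positive definite point with `S > 0` around it and
`|E|² ≤ ΛS²` at it. This file

* adds the `−ηS²` correction in coordinates (`chart_derivWithin_hamiltonU_le`: with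
  `∂ₜ(S²/4) = Δ(S²/4) − |∇S|²/2 + S|Ric|²`, `hasDerivWithinAt_scalAt_sq_div_four_ricciFlow`):
  `∂ₜ(F − ηS²) ≤ Δ(F − ηS²) + (2η − 1)|∇S|² + N(64√|Rm|² + S)|E|² − 4ηS|Ric|²`;
* transports it to a Ricci flow `(g, cov)` on `[0, T']` on a smooth 4-manifold
  (`helper_hamiltonEvolution`, the registered statement), exactly as Topping's Prop. 2.5.4 /
  Prop. 3.2.10 are transported in `RicciFlowScalarCurvatureEvolution.lean` /
  `RicciFlowCurvatureDoubling.lean`: the flow read in the chart at `x₀` is a coordinate Ricci flow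
  (`IsRicciFlow.isMetricFamilyOn_chartRep`, `tDeriv_chartRep_eq`), and the dictionary
  `scalAt_chartRep_eq` (`S ↔ R`), `gradSqAt_chartRep_eq` (`|∇S|² ↔ gradSq`),
  `chart_normSqAt_ricAt_eq` (`|Ric|²`, proved here at every point of the chart target),
  `curvNormSqWith_chartInv_eq` (`|Rm|²`), `lapAt_chartRep_eq` (`Δ`) identifies every term; in the
  manifold vocabulary `R = scalarCurvatureWith (cov t)`, `|∇R|² = (g t).gradSq R`,
  `|Ric|² = (g t).normSq x ((cov t).ricci x)`, `|Rm|² = curvNormSqWith`, `Δ = laplaceBeltrami`.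

Everything here is proved; no definition and no named fact is introduced.

## References

* R. S. Hamilton, *Three-manifolds with positive Ricci curvature*, J. Differential Geom. 17 (1982)
  255–306, §11, Lemmas 11.5–11.9, Thm. 11.1; §17, Lemma 17.4. [Hamilton1982]
* G. Huisken, *Ricci deformation of the metric on a Riemannian manifold*, J. Differential Geom. 21
  (1985) 47–62, §4, Thm. 4.1. [Huisken1985]
* P. Topping, *Lectures on the Ricci flow*, LMS Lecture Note Series 325, CUP 2006, §1.2.3,
  Prop. 2.5.4, Prop. 3.2.10. [Topping2006]
-/

noncomputable section

-- every `Summit.SmoothPoincare4.SmoothPoincare4.…` name repeats the summit = sub-problem segment (D-0017 layout)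
set_option linter.dupNamespace false
-- nested operator spaces of metric components (`E →L E →L ℝ` and their derivatives)
set_option maxSynthPendingDepth 3

open Set Function Filter Module
open scoped Manifold ContDiff Topology

namespace Summit.SmoothPoincare4.SmoothPoincare4.Theorems.MargerinRails

open Literature.Geometry.Riemannian
open Literature.Geometry.Lorentzian Literature.Geometry.Lorentzian.PseudoRiemannianMetric
open Literature.Geometry.Lorentzian.MetricCoord

/-! ### The `−ηS²` correction in coordinates -/

section Chart

variable {E : Type*} [NormedAddCommGroup E] [NormedSpace ℝ E] [FiniteDimensional ℝ E]
  [CompleteSpace E] {G : ℝ → E → E →L[ℝ] E →L[ℝ] ℝ} {S : Set ℝ} {V : Set E} {x : E} {t : ℝ}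

/-- **Hamilton's evolution inequality for `u = F − ηS²`, `F = |∇S|²/S + N|E|²`, in coordinates
(dimension 4).** Along `∂G/∂t = −2 Ric(G)` on `V × S`, at `t ∈ S` and a positive definite point
`x ∈ V` with `S(G t) > 0` on `V` and `|E|²(x) ≤ ΛS(x)²`, for `N = 180(1 + Λ)` and every real `η`:
`∂ₜu ≤ Δu + (2η − 1)|∇S|² + N(64√|Rm|² + S)|E|² − 4ηS|Ric|²` — the landed inequality for `F`
(`derivWithin_hamiltonF_le`, Hamilton 1982 Lemmas 11.5–11.9) minus `4η` times
`∂ₜ(S²/4) = Δ(S²/4) − |∇S|²/2 + S|Ric|²` (`hasDerivWithinAt_scalAt_sq_div_four_ricciFlow`).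
[cite: Hamilton1982, §11, Lemmas 11.5–11.9, Thm. 11.1] [cite: Huisken1985, §4, Thm. 4.1] -/
theorem chart_derivWithin_hamiltonU_le (hG : IsMetricFamilyOn G S V)
    (hfl : ∀ s ∈ S, ∀ y ∈ V, tDeriv G S s y = (-2 : ℝ) • ricAt (G s) y)
    (hx : x ∈ V) (ht : t ∈ S) (h4 : finrank ℝ E = 4)
    (hpos : ∀ v : E, v ≠ 0 → 0 < G t x v v) (hS : ∀ y ∈ V, 0 < scalAt (G t) y)
    {Λ : ℝ} (hΛ0 : 0 ≤ Λ)
    (hΛ : normSqAt (G t) x (ricAt (G t) x) - scalAt (G t) x ^ 2 / 4 ≤ Λ * scalAt (G t) x ^ 2)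
    (η : ℝ) :
    derivWithin (fun s ↦ gradSqAt (G s) (scalAt (G s)) x / scalAt (G s) x
        + 180 * (1 + Λ) * (normSqAt (G s) x (ricAt (G s) x) - scalAt (G s) x ^ 2 / 4)
        - η * scalAt (G s) x ^ 2) S t
      ≤ lapAt (G t) (fun y ↦ gradSqAt (G t) (scalAt (G t)) y / scalAt (G t) y
            + 180 * (1 + Λ) * (normSqAt (G t) y (ricAt (G t) y) - scalAt (G t) y ^ 2 / 4)
            - η * scalAt (G t) y ^ 2) x
        + ((2 * η - 1) * gradSqAt (G t) (scalAt (G t)) x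
          + 180 * (1 + Λ) * (64 * Real.sqrt (rmNormSqAt (G t) x) + scalAt (G t) x)
              * (normSqAt (G t) x (ricAt (G t) x) - scalAt (G t) x ^ 2 / 4)
          - 4 * η * (scalAt (G t) x * normSqAt (G t) x (ricAt (G t) x))) := by
  classical
  have hGt := hG.isMetricOn t ht
  have hV := hG.isOpen ht
  have hU := hG.uniqueDiffOn t ht
  set b := Module.finBasis ℝ E with hb
  have hSpos : 0 < scalAt (G t) x := hS x hx
  have hSne : scalAt (G t) x ≠ 0 := hSpos.ne'
  -- the landed inequality for `F`
  have hF_le := hG.derivWithin_hamiltonF_le hfl hx ht h4 hpos hS hΛ0 hΛ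
  -- time derivatives of the pieces
  have hVt := hG.hasDerivWithinAt_gradSqAt_scalAt_ricciFlow hfl hx ht
  have hSt := hG.hasDerivWithinAt_scalAt_ricciFlow hfl hx ht
  have hRic := hG.hasDerivWithinAt_normSqAt_ricAt_ricciFlow b hfl hx ht
  have hSq := hG.hasDerivWithinAt_scalAt_sq_div_four_ricciFlow hfl hx ht
  have hFd : DifferentiableWithinAt ℝ (fun s ↦ gradSqAt (G s) (scalAt (G s)) x / scalAt (G s) x
      + 180 * (1 + Λ) * (normSqAt (G s) x (ricAt (G s) x) - scalAt (G s) x ^ 2 / 4)) S t :=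
    ((hVt.div hSt hSne).add ((hRic.sub hSq).const_mul (180 * (1 + Λ)))).differentiableWithinAt
  -- `ηS² = 4η · (S²/4)` in time …
  have hfun : (fun s ↦ gradSqAt (G s) (scalAt (G s)) x / scalAt (G s) x
      + 180 * (1 + Λ) * (normSqAt (G s) x (ricAt (G s) x) - scalAt (G s) x ^ 2 / 4)
      - η * scalAt (G s) x ^ 2) = fun s ↦ (gradSqAt (G s) (scalAt (G s)) x / scalAt (G s) x
      + 180 * (1 + Λ) * (normSqAt (G s) x (ricAt (G s) x) - scalAt (G s) x ^ 2 / 4))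
      - 4 * η * (scalAt (G s) x ^ 2 / 4) := by
    funext s; ring
  have hu : HasDerivWithinAt (fun s ↦ (gradSqAt (G s) (scalAt (G s)) x / scalAt (G s) x
      + 180 * (1 + Λ) * (normSqAt (G s) x (ricAt (G s) x) - scalAt (G s) x ^ 2 / 4))
      - 4 * η * (scalAt (G s) x ^ 2 / 4))
      (derivWithin (fun s ↦ gradSqAt (G s) (scalAt (G s)) x / scalAt (G s) x
        + 180 * (1 + Λ) * (normSqAt (G s) x (ricAt (G s) x) - scalAt (G s) x ^ 2 / 4)) S t
      - 4 * η * (lapAt (G t) (fun y ↦ scalAt (G t) y ^ 2 / 4) x - gradSqAt (G t) (scalAt (G t)) x / 2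
        + scalAt (G t) x * normSqAt (G t) x (ricAt (G t) x))) S t :=
    hFd.hasDerivWithinAt.sub (hSq.const_mul (4 * η))
  rw [hfun, hu.derivWithin hU]
  -- … and in space
  have hScont : ContDiffOn ℝ ∞ (scalAt (G t)) V := hGt.contDiffOn_scalAt
  have hVcont : ContDiffOn ℝ ∞ (gradSqAt (G t) (scalAt (G t))) V := hGt.contDiffOn_gradSqAt hScont
  have hucont : ContDiffOn ℝ ∞ (fun y ↦ gradSqAt (G t) (scalAt (G t)) y / scalAt (G t) y) V :=
    hVcont.div hScont fun y hy ↦ (hS y hy).ne'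
  have hRcont : ContDiffOn ℝ ∞ (fun y ↦ normSqAt (G t) y (ricAt (G t) y)) V :=
    hGt.contDiffOn_normSqAt hGt.contDiffOn_ricAt
  have hEcont : ContDiffOn ℝ ∞
      (fun y ↦ normSqAt (G t) y (ricAt (G t) y) - scalAt (G t) y ^ 2 / 4) V :=
    hRcont.sub ((hScont.pow 2).div_const 4)
  have hFcont : ContDiffOn ℝ ∞ (fun y ↦ gradSqAt (G t) (scalAt (G t)) y / scalAt (G t) y
      + 180 * (1 + Λ) * (normSqAt (G t) y (ricAt (G t) y) - scalAt (G t) y ^ 2 / 4)) V :=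
    hucont.add (contDiffOn_const.mul hEcont)
  have two : (2 : ℕ∞ω) ≤ ∞ := WithTop.coe_le_coe.mpr le_top
  have hF2 : ContDiffAt ℝ 2 (fun y ↦ gradSqAt (G t) (scalAt (G t)) y / scalAt (G t) y
      + 180 * (1 + Λ) * (normSqAt (G t) y (ricAt (G t) y) - scalAt (G t) y ^ 2 / 4)) x :=
    (hFcont.contDiffAt (hV.mem_nhds hx)).of_le two
  have hS2q : ContDiffAt ℝ 2 (fun y ↦ scalAt (G t) y ^ 2 / 4) x :=
    (((hScont.pow 2).div_const 4).contDiffAt (hV.mem_nhds hx)).of_le two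
  have hfun' : (fun y ↦ gradSqAt (G t) (scalAt (G t)) y / scalAt (G t) y
      + 180 * (1 + Λ) * (normSqAt (G t) y (ricAt (G t) y) - scalAt (G t) y ^ 2 / 4)
      - η * scalAt (G t) y ^ 2) = fun y ↦ (gradSqAt (G t) (scalAt (G t)) y / scalAt (G t) y
      + 180 * (1 + Λ) * (normSqAt (G t) y (ricAt (G t) y) - scalAt (G t) y ^ 2 / 4))
      - 4 * η * (scalAt (G t) y ^ 2 / 4) := by
    funext y; ring
  rw [hfun', lapAt_sub (G t) hF2 (contDiffAt_const.mul hS2q), lapAt_const_mul (G t) hS2q]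
  linarith only [hF_le]

end Chart

/-! ### Transport to the manifold -/

section Manifold

variable {M : Type*} [TopologicalSpace M] [ChartedSpace (EuclideanSpace ℝ (Fin 4)) M]
  [IsManifold (𝓡 4) ∞ M]
  {g : ℝ → PseudoRiemannianMetric (𝓡 4) ∞ (EuclideanSpace ℝ (Fin 4)) (TangentSpace (𝓡 4) : M → Type _)}
  {cov : ℝ → CovariantDerivative (𝓡 4) (EuclideanSpace ℝ (Fin 4)) (TangentSpace (𝓡 4) : M → Type _)}
  {T' : ℝ}

/-- **`|Ric|²` of the flow read in the chart**, at every point of the chart target: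
`|Ric(G s)|²(u) = |Ric(g s)|²(Φ u)` for the Levi-Civita witness `cov s` (`normSq_chartPullback_eq`,
`ricci_comap_apply`, `OpensChart.normSq_ricci_eq_normSqAt`, `IsLeviCivita.ricci_eq_ricci`); the
`(𝓡 4)`-instance of `normSqAt_chartRep_ricAt_eq` of the sibling file `…StubGradientEstimatesSmooth`
(kept local so that this file does not depend on it). [cite: Topping2006, Prop. 2.5.4] -/
theorem chart_normSqAt_ricAt_eq (hflow : IsRicciFlow g cov (Icc 0 T')) (x₀ : M) {s : ℝ}
    (hs : s ∈ Icc 0 T') (u : chartTarget (𝓡 4) x₀) :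
    normSqAt (chartRep (𝓡 4) g x₀ s) u (ricAt (chartRep (𝓡 4) g x₀ s) u) =
      (g s).normSq (chartInv (𝓡 4) x₀ u) ((cov s).ricci (chartInv (𝓡 4) x₀ u)) := by
  haveI := (g s).hasLeviCivita
  haveI := (chartPullback (𝓡 4) (g s) x₀).hasLeviCivita
  have h2 : (2 : ℕ∞ω) ≤ ∞ := WithTop.coe_le_coe.mpr le_top
  have hG := val_chartPullback_eq_chartRep g x₀ s
  rw [← OpensChart.normSq_ricci_eq_normSqAt hG u,
    normSq_chartPullback_eq (g s) x₀ u _ ((g s).ricci (chartInv (𝓡 4) x₀ u))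
      (fun v w ↦ (g s).ricci_comap_apply contMDiff_pullbackBilin_holds (contMDiff_chartInv x₀)
        (injective_mfderiv_chartInv x₀) rfl u v w),
    (hflow.isLeviCivita s hs).ricci_eq_ricci h2]

/-- A function whose chart representative at `x₀` is `C^∞` on the chart target is `C^∞` at `x₀`
(the pattern of `contMDiffAt_curvNormSqWith`). [folklore] -/
theorem contMDiffAt_of_chart_eq (x₀ : M) {F : M → ℝ} {Fc : EuclideanSpace ℝ (Fin 4) → ℝ}
    (hrep : ∀ y : chartTarget (𝓡 4) x₀, F (chartInv (𝓡 4) x₀ y) = Fc y)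
    (hFc : ContDiffOn ℝ ∞ Fc (extChartAt (𝓡 4) x₀).target) :
    ContMDiffAt (𝓡 4) 𝓘(ℝ, ℝ) ∞ F x₀ := by
  have hΦ : ContMDiffOn (𝓡 4) 𝓘(ℝ, EuclideanSpace ℝ (Fin 4)) ∞ (extChartAt (𝓡 4) x₀)
      (chartAt (EuclideanSpace ℝ (Fin 4)) x₀).source := contMDiffOn_extChartAt
  have hmaps : MapsTo (extChartAt (𝓡 4) x₀) (chartAt (EuclideanSpace ℝ (Fin 4)) x₀).source
      (extChartAt (𝓡 4) x₀).target := by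
    intro y hy
    exact (extChartAt (𝓡 4) x₀).map_source (by rw [extChartAt_source]; exact hy)
  have hcomp := (contMDiffOn_iff_contDiffOn.2 hFc).comp hΦ hmaps
  have heq : ∀ y ∈ (chartAt (EuclideanSpace ℝ (Fin 4)) x₀).source,
      F y = (Fc ∘ extChartAt (𝓡 4) x₀) y := by
    intro y hy
    have hyt : extChartAt (𝓡 4) x₀ y ∈ (extChartAt (𝓡 4) x₀).target := hmaps hy
    have hinv : chartInv (𝓡 4) x₀ ⟨extChartAt (𝓡 4) x₀ y, hyt⟩ = y :=
      (extChartAt (𝓡 4) x₀).left_inv (by rw [extChartAt_source]; exact hy)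
    rw [Function.comp_apply, ← hrep ⟨extChartAt (𝓡 4) x₀ y, hyt⟩, hinv]
  exact ((hcomp.congr heq) x₀ (mem_chart_source _ x₀)).contMDiffAt
    ((chartAt (EuclideanSpace ℝ (Fin 4)) x₀).open_source.mem_nhds (mem_chart_source _ x₀))

/-- **Hamilton's evolution inequality for `u = |∇R|²/R + N|E|² − ηR²` along a Ricci flow on a
smooth 4-manifold** (Hamilton 1982, §11, Lemmas 11.5–11.9 / Thm. 11.1 and Lemma 17.4; Huisken
1985, Thm. 4.1): for a Ricci flow `(g, cov)` of Riemannian metrics on `[0, T']`, `T' > 0`, at a time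
`t` where `R > 0` on `M` and a point `x` where `|E|² ≤ ΛR²` (`Λ ≥ 0`), with `N = 180(1 + Λ)` and any
real `η`, the function `u = |∇R|²/R + N(|Ric|² − R²/4) − ηR²` satisfies
`∂ₜu ≤ Δ_{g(t)}u + (2η − 1)|∇R|² + N(64√|Rm|² + R)|E|² − 4ηR|Ric|²` at `(x, t)` (`∂ₜ` within
`[0, T']`, `R = scalarCurvatureWith`, `|∇R|² = gradSq`, `|Ric|² = normSq Ric`, `|Rm|² = curvNormSqWith`,
`Δ = laplaceBeltrami`): the coordinate inequality `chart_derivWithin_hamiltonU_le` in the chart at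
`x`, transported by the chart dictionary. Registered helper H0 of `stub_gradientEstimates`.
[cite: Hamilton1982, §11, Thm. 11.1 and §17, Lemma 17.4] [cite: Huisken1985, §4, Thm. 4.1] -/
theorem helper_hamiltonEvolution : ∀ (M : Type) [TopologicalSpace M] [T2Space M] [SecondCountableTopology M] [ChartedSpace (EuclideanSpace ℝ (Fin 4)) M] [IsManifold (𝓡 4) ∞ M] (g : ℝ → PseudoRiemannianMetric (𝓡 4) ∞ (EuclideanSpace ℝ (Fin 4)) (TangentSpace (𝓡 4) : M → Type _)) (cov : ℝ → CovariantDerivative (𝓡 4) (EuclideanSpace ℝ (Fin 4)) (TangentSpace (𝓡 4) : M → Type _)) (T' Λ η : ℝ), 0 < T' → 0 ≤ Λ → IsRicciFlow g cov (Icc 0 T') → (∀ t ∈ Icc 0 T', (g t).IsRiemannian) → ∀ t ∈ Icc 0 T', (∀ y : M, 0 < (g t).scalarCurvatureWith (cov t) y) → ∀ x : M, (g t).normSq x ((cov t).ricci x) - (g t).scalarCurvatureWith (cov t) x ^ 2 / 4 ≤ Λ * (g t).scalarCurvatureWith (cov t) x ^ 2 → derivWithin (fun s ↦ (g s).gradSq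 (fun y ↦ (g s).scalarCurvatureWith (cov s) y) x / (g s).scalarCurvatureWith (cov s) x + 180 * (1 + Λ) * ((g s).normSq x ((cov s).ricci x) - (g s).scalarCurvatureWith (cov s) x ^ 2 / 4) - η * (g s).scalarCurvatureWith (cov s) x ^ 2) (Icc 0 T') t ≤ (g t).laplaceBeltrami (fun y ↦ (g t).gradSq (fun z ↦ (g t).scalarCurvatureWith (cov t) z) y / (g t).scalarCurvatureWith (cov t) y + 180 * (1 + Λ) * ((g t).normSq y ((cov t).ricci y) - (g t).scalarCurvatureWith (cov t) y ^ 2 / 4) - η * (g t).scalarCurvatureWith (cov t) y ^ 2) x + ((2 * η - 1) * (g t).gradSq (fun y ↦ (g t).scalarCurvatureWith (cov t) y) x + 180 * (1 + Λ) * (64 * Real.sqrt ((g t).curvNormSqWith (cov t) x) + (g t).scalarCurvatureWith (cov t) x) * ((g t).normSq x ((cov t).ricci x) - (g t).scalarCurvatureWith (cov t) x ^ 2 / 4) - 4 * η * ((g t).scalarCurvatureWith (cov t) x * (g t).normSq x ((cov t).ricci x))) := by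
  intro M _ _ _ _ _ g cov T' Λ η hT' hΛ0 hflow hR t ht hRpos x₀ hΛ
  have two : (2 : ℕ∞ω) ≤ ∞ := WithTop.coe_le_coe.mpr le_top
  -- (1) the flow read in the chart at `x₀` is a coordinate Ricci flow
  have hfam := hflow.isMetricFamilyOn_chartRep hT' x₀
  have hfl : ∀ s ∈ Icc 0 T', ∀ y ∈ (extChartAt (𝓡 4) x₀).target,
      tDeriv (chartRep (𝓡 4) g x₀) (Icc 0 T') s y = (-2 : ℝ) • ricAt (chartRep (𝓡 4) g x₀ s) y :=
    fun s hs y hy ↦ hflow.tDeriv_chartRep_eq hT' x₀ hs hy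
  have hu₀ : extChartAt (𝓡 4) x₀ x₀ ∈ (extChartAt (𝓡 4) x₀).target := mem_extChartAt_target x₀
  set u₀ : chartTarget (𝓡 4) x₀ := ⟨extChartAt (𝓡 4) x₀ x₀, hu₀⟩ with hu₀def
  have hΦu₀ : chartInv (𝓡 4) x₀ u₀ = x₀ := extChartAt_to_inv x₀
  have hVopen : IsOpen (extChartAt (𝓡 4) x₀).target := isOpen_extChartAt_target x₀
  -- (2) the dictionary, at every time and every point of the chart target
  have hscal : ∀ s ∈ Icc 0 T', ∀ u : chartTarget (𝓡 4) x₀,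
      scalAt (chartRep (𝓡 4) g x₀ s) u = (g s).scalarCurvatureWith (cov s) (chartInv (𝓡 4) x₀ u) :=
    fun s hs u ↦ hflow.scalAt_chartRep_eq x₀ hs u
  have hnorm : ∀ s ∈ Icc 0 T', ∀ u : chartTarget (𝓡 4) x₀,
      normSqAt (chartRep (𝓡 4) g x₀ s) u (ricAt (chartRep (𝓡 4) g x₀ s) u) =
        (g s).normSq (chartInv (𝓡 4) x₀ u) ((cov s).ricci (chartInv (𝓡 4) x₀ u)) :=
    fun s hs u ↦ chart_normSqAt_ricAt_eq hflow x₀ hs u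
  have hRsmooth : ∀ s ∈ Icc 0 T', ContMDiff (𝓡 4) 𝓘(ℝ, ℝ) ∞
      (fun y ↦ (g s).scalarCurvatureWith (cov s) y) := fun s hs ↦
    (hflow.isLeviCivita s hs).contMDiff_trace_ricci
  have hgrad : ∀ s ∈ Icc 0 T', ∀ u : chartTarget (𝓡 4) x₀,
      gradSqAt (chartRep (𝓡 4) g x₀ s) (scalAt (chartRep (𝓡 4) g x₀ s)) u =
        (g s).gradSq (fun y ↦ (g s).scalarCurvatureWith (cov s) y) (chartInv (𝓡 4) x₀ u) := by
    intro s hs u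
    refine gradSqAt_chartRep_eq g x₀ s u (F := fun y ↦ (g s).scalarCurvatureWith (cov s) y)
      (Fc := scalAt (chartRep (𝓡 4) g x₀ s)) (fun y ↦ (hscal s hs y).symm) ?_ ?_
    · exact ((hRsmooth s hs) _).mdifferentiableAt (by simp)
    · exact ((hfam.isMetricOn s hs).contDiffAt_scalAt u.2).differentiableAt (by simp)
  have hrm : ∀ s ∈ Icc 0 T', rmNormSqAt (chartRep (𝓡 4) g x₀ s) u₀ = (g s).curvNormSqWith (cov s) x₀ :=
    fun s hs ↦ by
      have h := curvNormSqWith_chartInv_eq (hflow.isLeviCivita s hs) x₀ u₀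
      rw [hΦu₀] at h
      exact h.symm
  -- (3) the coordinate inequality at `(u₀, t)`
  have hpos : ∀ v : EuclideanSpace ℝ (Fin 4), v ≠ 0 → 0 < chartRep (𝓡 4) g x₀ t u₀ v v :=
    fun v hv ↦ chartRep_posDef g x₀ t (hR t ht) u₀ v hv
  have hS : ∀ y ∈ (extChartAt (𝓡 4) x₀).target, 0 < scalAt (chartRep (𝓡 4) g x₀ t) y := by
    intro y hy
    rw [hscal t ht ⟨y, hy⟩]
    exact hRpos _
  have hΛ' : normSqAt (chartRep (𝓡 4) g x₀ t) u₀ (ricAt (chartRep (𝓡 4) g x₀ t) u₀)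
      - scalAt (chartRep (𝓡 4) g x₀ t) u₀ ^ 2 / 4 ≤ Λ * scalAt (chartRep (𝓡 4) g x₀ t) u₀ ^ 2 := by
    rw [hnorm t ht u₀, hscal t ht u₀, hΦu₀]
    exact hΛ
  have key := chart_derivWithin_hamiltonU_le hfam hfl hu₀ ht finrank_euclideanSpace_fin hpos hS
    hΛ0 hΛ' η
  -- (4) transport of the function (time direction)
  have hfun : ∀ s ∈ Icc 0 T',
      (g s).gradSq (fun y ↦ (g s).scalarCurvatureWith (cov s) y) x₀ / (g s).scalarCurvatureWith (cov s) x₀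
        + 180 * (1 + Λ) * ((g s).normSq x₀ ((cov s).ricci x₀) - (g s).scalarCurvatureWith (cov s) x₀ ^ 2 / 4)
        - η * (g s).scalarCurvatureWith (cov s) x₀ ^ 2 =
      gradSqAt (chartRep (𝓡 4) g x₀ s) (scalAt (chartRep (𝓡 4) g x₀ s)) u₀
          / scalAt (chartRep (𝓡 4) g x₀ s) u₀
        + 180 * (1 + Λ) * (normSqAt (chartRep (𝓡 4) g x₀ s) u₀ (ricAt (chartRep (𝓡 4) g x₀ s) u₀)
          - scalAt (chartRep (𝓡 4) g x₀ s) u₀ ^ 2 / 4)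
        - η * scalAt (chartRep (𝓡 4) g x₀ s) u₀ ^ 2 := by
    intro s hs
    rw [hgrad s hs u₀, hnorm s hs u₀, hscal s hs u₀, hΦu₀]
  have hderiv : derivWithin (fun s ↦
      (g s).gradSq (fun y ↦ (g s).scalarCurvatureWith (cov s) y) x₀ / (g s).scalarCurvatureWith (cov s) x₀
        + 180 * (1 + Λ) * ((g s).normSq x₀ ((cov s).ricci x₀) - (g s).scalarCurvatureWith (cov s) x₀ ^ 2 / 4)
        - η * (g s).scalarCurvatureWith (cov s) x₀ ^ 2) (Icc 0 T') t =
      derivWithin (fun s ↦ gradSqAt (chartRep (𝓡 4) g x₀ s) (scalAt (chartRep (𝓡 4) g x₀ s)) u₀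
          / scalAt (chartRep (𝓡 4) g x₀ s) u₀
        + 180 * (1 + Λ) * (normSqAt (chartRep (𝓡 4) g x₀ s) u₀ (ricAt (chartRep (𝓡 4) g x₀ s) u₀)
          - scalAt (chartRep (𝓡 4) g x₀ s) u₀ ^ 2 / 4)
        - η * scalAt (chartRep (𝓡 4) g x₀ s) u₀ ^ 2) (Icc 0 T') t :=
    derivWithin_congr (fun s hs ↦ hfun s hs) (hfun t ht)
  -- (5) transport of the Laplacian (space direction, at time `t`)
  have hGt := hfam.isMetricOn t ht
  have hScont : ContDiffOn ℝ ∞ (scalAt (chartRep (𝓡 4) g x₀ t)) (extChartAt (𝓡 4) x₀).target :=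
    hGt.contDiffOn_scalAt
  have hVcont := hGt.contDiffOn_gradSqAt hScont
  have hRcont : ContDiffOn ℝ ∞ (fun y ↦ normSqAt (chartRep (𝓡 4) g x₀ t) y
      (ricAt (chartRep (𝓡 4) g x₀ t) y)) (extChartAt (𝓡 4) x₀).target :=
    hGt.contDiffOn_normSqAt hGt.contDiffOn_ricAt
  have hUc : ContDiffOn ℝ ∞ (fun y ↦ gradSqAt (chartRep (𝓡 4) g x₀ t) (scalAt (chartRep (𝓡 4) g x₀ t)) y
        / scalAt (chartRep (𝓡 4) g x₀ t) y
      + 180 * (1 + Λ) * (normSqAt (chartRep (𝓡 4) g x₀ t) y (ricAt (chartRep (𝓡 4) g x₀ t) y)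
        - scalAt (chartRep (𝓡 4) g x₀ t) y ^ 2 / 4)
      - η * scalAt (chartRep (𝓡 4) g x₀ t) y ^ 2) (extChartAt (𝓡 4) x₀).target :=
    ((hVcont.div hScont fun y hy ↦ (hS y hy).ne').add
      (contDiffOn_const.mul (hRcont.sub ((hScont.pow 2).div_const 4)))).sub
      (contDiffOn_const.mul (hScont.pow 2))
  have hrep : ∀ y : chartTarget (𝓡 4) x₀,
      (fun z ↦ (g t).gradSq (fun w ↦ (g t).scalarCurvatureWith (cov t) w) z / (g t).scalarCurvatureWith (cov t) z
        + 180 * (1 + Λ) * ((g t).normSq z ((cov t).ricci z) - (g t).scalarCurvatureWith (cov t) z ^ 2 / 4)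
        - η * (g t).scalarCurvatureWith (cov t) z ^ 2) (chartInv (𝓡 4) x₀ y) =
      gradSqAt (chartRep (𝓡 4) g x₀ t) (scalAt (chartRep (𝓡 4) g x₀ t)) y
          / scalAt (chartRep (𝓡 4) g x₀ t) y
        + 180 * (1 + Λ) * (normSqAt (chartRep (𝓡 4) g x₀ t) y (ricAt (chartRep (𝓡 4) g x₀ t) y)
          - scalAt (chartRep (𝓡 4) g x₀ t) y ^ 2 / 4)
        - η * scalAt (chartRep (𝓡 4) g x₀ t) y ^ 2 := by
    intro y
    simp only [hgrad t ht y, hnorm t ht y, hscal t ht y]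
  have hF : ContMDiffAt (𝓡 4) 𝓘(ℝ, ℝ) 2
      (fun z ↦ (g t).gradSq (fun w ↦ (g t).scalarCurvatureWith (cov t) w) z / (g t).scalarCurvatureWith (cov t) z
        + 180 * (1 + Λ) * ((g t).normSq z ((cov t).ricci z) - (g t).scalarCurvatureWith (cov t) z ^ 2 / 4)
        - η * (g t).scalarCurvatureWith (cov t) z ^ 2) (chartInv (𝓡 4) x₀ u₀) := by
    rw [hΦu₀]
    exact (contMDiffAt_of_chart_eq x₀ hrep hUc).of_le two
  have hFc : ContDiffAt ℝ 2 (fun y ↦ gradSqAt (chartRep (𝓡 4) g x₀ t) (scalAt (chartRep (𝓡 4) g x₀ t)) y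
        / scalAt (chartRep (𝓡 4) g x₀ t) y
      + 180 * (1 + Λ) * (normSqAt (chartRep (𝓡 4) g x₀ t) y (ricAt (chartRep (𝓡 4) g x₀ t) y)
        - scalAt (chartRep (𝓡 4) g x₀ t) y ^ 2 / 4)
      - η * scalAt (chartRep (𝓡 4) g x₀ t) y ^ 2) (u₀ : EuclideanSpace ℝ (Fin 4)) :=
    (hUc.contDiffAt (hVopen.mem_nhds hu₀)).of_le two
  have hlap := lapAt_chartRep_eq g x₀ t u₀ hrep hF hFc
  rw [hΦu₀] at hlap
  -- (6) assemble
  rw [hlap, hrm t ht, hgrad t ht u₀, hnorm t ht u₀, hscal t ht u₀, hΦu₀] at key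
  rw [hderiv]
  exact key

end Manifold

end Summit.SmoothPoincare4.SmoothPoincare4.Theorems.MargerinRails

end
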